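/-
Copyright: the b2b-balaban T⁴-continuum CRUX team, row NE7b leaf lineage `t4-ne7b-formalise-leaf-03` (gen 142). Project licence.
-/
import Mathlib.Analysis.Calculus.ParametricIntegral
import Mathlib.Analysis.Calculus.ContDiff.Basic
import Mathlib.Analysis.Calculus.Gradient.Basic
import Mathlib.Analysis.SpecialFunctions.ExpDeriv
import Mathlib.Analysis.SpecialFunctions.Log.Deriv
import Mathlib.Analysis.InnerProductSpace.PiL2
import Mathlib.MeasureTheory.Measure.Haar.InnerProductSpace
import Mathlib.MeasureTheory.Integral.Bochner.ContinuousLinearMap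
import Mathlib.MeasureTheory.Function.LocallyIntegrable

/-!
# THE MARGINAL EXPONENT OVER A BOUNDED FIBRE WINDOW IS `C¹` FOR A JOINTLY `C¹` EXPONENT — domination DISCHARGED by compactness:
# `x ↦ −log ∫_F e^{−V(x,y)} dy` is differentiable on all of `ℝᵐ`, with `⟪∇V⁺(x), v⟫ = (∫_F e^{−V}·DV(x,y)[(v,0)] dy) ∕ ∫_F e^{−V}`, and
# differentiable WITHIN a closed base window in `…LogConcaveMarginal`'s fibre form (row NE7b, node U5c; residual (R2′) family (2),
# letter (ℓ1); the `ContDiff` supplier complementing `…LogConcaveMarginalDeriv`; kernel lemmas of real analysis)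

Cell `pub-balaban`, sub-cell `t4`, spine estimate NE7b (`T4WeightBudget.RelWeightBound`; the cell's OWN estimate — NOT PRINTED in
[Bałaban 1983–89], NOT PROVED).  Crux-route work under `Spine/NE7b/` by a row leaf on the convexity road; NOTHING of Bałaban's is named
or asserted; no `T4Continuum/Support` leaf typed; no `def`; zero `sorry`.  Imports: Mathlib only — independent of the farm's olean
frontier.

WHY.  The OWNER's `…LogConcaveMarginalDeriv` differentiates the fibre integral `x ↦ ∫ e^{−V(x,y)} dμ(y)` under DISPLAYED letters (a
domination `bound`, or in its bounded form a finite fibre measure with displayed numbers `vmin ≤ V`, `‖Vx‖ ≤ M` on `U × α`) and joins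
`…LogConcaveMarginal`'s fibre form at INTERIOR base points (`B ∈ 𝓝 x₀`).  THIS FILE is the complementary supplier in which those letters are
THEOREMS: for `V : ℝᵐ × ℝⁿ → ℝ` with `ContDiff ℝ 1 V` and a fibre window `F ⊆ ℝⁿ` that is measurable and BOUNDED, continuity of
`e^{−V}‖DV ∘ inl‖` on the compact `B̄(x₀,1) × F̄` supplies the domination, so `x ↦ −log ∫_F e^{−V(x,y)} dy` is differentiable at EVERY
base point with no displayed number (`volume F ≠ 0` for the logarithm); the gradient is written out against a direction `v` as the
fibre-tilted mean of `DV(x,y)[(v,0)]`; and for a base window `B` that may be CLOSED the windowed marginal of `…LogConcaveMarginal`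
(`∫_{(B ×ˢ F)_x}`) is differentiable WITHIN `B` at every `x ∈ B` — the hypothesis of the within-window conversion
`…StrongConvexFirstOrderWithin.firstOrderOn_within_of_strongConvexOn`.

WHAT IS PROVED ([folklore]):
* §1 `hasFDerivAt_base_of_contDiff` (the base partial derivative `DV ∘ inl`), `integrableOn_fibreWindow_of_continuous` (continuous on
  `ℝᵐ × ℝⁿ` ⟹ integrable on every bounded fibre window), `fibreWindowIntegral_pos` (`volume F ≠ 0`),
  **`hasFDerivAt_fibreWindowIntegral`** (`ContDiff ℝ 1 V`, `F` measurable bounded ⊢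
  `HasFDerivAt (x ↦ ∫_F e^{−V(x,y)} dy) (−∫_F e^{−V(x₀,y)} • (DV(x₀,y) ∘ inl) dy) x₀`, Mathlib's
  `hasFDerivAt_integral_of_dominated_of_fderiv_le` with the compactness bound), **`hasFDerivAt_negLogFibreWindowIntegral`**,
  **`differentiable_negLogFibreWindowIntegral`** (`Differentiable ℝ` on all of `ℝᵐ`), **`inner_gradient_negLogFibreWindowIntegral`**
  (`⟪∇V⁺(x₀), v⟫ = (∫_F e^{−V(x₀,y)}·DV(x₀,y)[(v,0)] dy) ∕ ∫_F e^{−V(x₀,y)} dy`).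
* §2 **`differentiableWithinAt_negLogMarginal_prod`**: `x ∈ B` ⊢ `DifferentiableWithinAt ℝ (x ↦ −log ∫_{(B ×ˢ F)_x} e^{−V(x,·)}) B x`
  (closed base windows and boundary points allowed; on `B` the windowed marginal IS §1's function).
* §3 a non-vacuity `example` (`V = 0`, `F` = the unit ball).

NOT HERE (honest): the abstract-fibre statements with displayed letters and the interior-point junction (the OWNER's
`…LogConcaveMarginalDeriv`, not repeated); joint (non-product) windows; unbounded fibre windows; which of print's steps have this form
((A3) ∕ (A1c) readings — programme-sized, NC-NE7b-α UNRULED); anything of Bałaban's.  NE7b NOT PRINTED ∕ NOT PROVED; spine PROVED 0∕9;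
rung (B)+1 on a FINITE torus — NOT infinite volume, NOT the mass gap, NOT Clay.
HONEST DEPENDENCY: continuum YM on T⁴ ⇐ BetaPertH ∧ nine spine estimates (0/9 proved); BetaPertH ⇐ (D1) ∧ (D4) ∧ CAP+tail; G-an2-4
gates asym, D1 and NE2/3/4.
-/

set_option autoImplicit false

noncomputable section

open MeasureTheory Real Set Filter Topology Metric InnerProductSpace
open scoped RealInnerProductSpace

namespace Summit.QuantumFields.BalabanUV.T4Continuum.NE7b.FibreWindowSmooth

/-! ## §1 A bounded fibre window in `ℝⁿ` and a jointly `C¹` exponent on `ℝᵐ × ℝⁿ`: domination by compactness -/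

section Window

variable {m n : ℕ}

/-- The base partial derivative of a `C¹` function on the product: `HasFDerivAt (x ↦ V(x,y)) (DV(x,y) ∘ inl) x`. [folklore] -/
theorem hasFDerivAt_base_of_contDiff {V : EuclideanSpace ℝ (Fin m) × EuclideanSpace ℝ (Fin n) → ℝ} (hV : ContDiff ℝ 1 V)
    (x : EuclideanSpace ℝ (Fin m)) (y : EuclideanSpace ℝ (Fin n)) :
    HasFDerivAt (fun x' => V (x', y))
      ((fderiv ℝ V (x, y)).comp (ContinuousLinearMap.inl ℝ (EuclideanSpace ℝ (Fin m)) (EuclideanSpace ℝ (Fin n)))) x :=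
  ((hV.differentiable one_ne_zero) (x, y)).hasFDerivAt.comp x (hasFDerivAt_prodMk_left x y)

/-- A continuous function on `ℝᵐ × ℝⁿ` (with values in a normed group) is integrable over every bounded measurable fibre window
`{x} × F`. [folklore] -/
theorem integrableOn_fibreWindow_of_continuous {G : Type*} [NormedAddCommGroup G]
    {f : EuclideanSpace ℝ (Fin m) × EuclideanSpace ℝ (Fin n) → G} (hf : Continuous f)
    {F : Set (EuclideanSpace ℝ (Fin n))} (hFb : Bornology.IsBounded F) (x : EuclideanSpace ℝ (Fin m)) :
    IntegrableOn (fun y => f (x, y)) F := by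
  have hc : ContinuousOn (fun y => f (x, y)) (closure F) := (hf.comp (Continuous.prodMk_right x)).continuousOn
  exact (hc.integrableOn_compact hFb.isCompact_closure).mono_set subset_closure

/-- The fibre-window mass `∫_F e^{−V(x,y)} dy` is positive when `volume F ≠ 0` (`V` continuous, `F` bounded). [folklore] -/
theorem fibreWindowIntegral_pos {V : EuclideanSpace ℝ (Fin m) × EuclideanSpace ℝ (Fin n) → ℝ} (hVc : Continuous V)
    {F : Set (EuclideanSpace ℝ (Fin n))} (hFb : Bornology.IsBounded F) (hF0 : volume F ≠ 0) (x : EuclideanSpace ℝ (Fin m)) :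
    0 < ∫ y in F, exp (-V (x, y)) := by
  haveI : NeZero (volume F) := ⟨hF0⟩
  exact integral_exp_pos (integrableOn_fibreWindow_of_continuous (continuous_exp.comp hVc.neg) hFb x)

/-- **DIFFERENTIATION UNDER A BOUNDED FIBRE WINDOW**: for `V : ℝᵐ × ℝⁿ → ℝ` jointly `C¹` and `F ⊆ ℝⁿ` measurable and bounded,
`x ↦ ∫_F e^{−V(x,y)} dy` has Fréchet derivative `−∫_F e^{−V(x₀,y)} • (DV(x₀,y) ∘ inl) dy` at every `x₀` (domination by the maximum
of the continuous `e^{−V}‖DV ∘ inl‖` on the compact `B̄(x₀,1) × F̄`). [folklore] -/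
theorem hasFDerivAt_fibreWindowIntegral {V : EuclideanSpace ℝ (Fin m) × EuclideanSpace ℝ (Fin n) → ℝ} (hV : ContDiff ℝ 1 V)
    {F : Set (EuclideanSpace ℝ (Fin n))} (hF : MeasurableSet F) (hFb : Bornology.IsBounded F) (x₀ : EuclideanSpace ℝ (Fin m)) :
    HasFDerivAt (fun x => ∫ y in F, exp (-V (x, y)))
      (-∫ y in F, exp (-V (x₀, y)) •
        (fderiv ℝ V (x₀, y)).comp (ContinuousLinearMap.inl ℝ (EuclideanSpace ℝ (Fin m)) (EuclideanSpace ℝ (Fin n)))) x₀ := by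
  have hVc : Continuous V := hV.continuous
  have hDc : Continuous (fderiv ℝ V) := hV.continuous_fderiv one_ne_zero
  have hGc : Continuous fun p : EuclideanSpace ℝ (Fin m) × EuclideanSpace ℝ (Fin n) =>
      exp (-V p) * ‖(fderiv ℝ V p).comp
        (ContinuousLinearMap.inl ℝ (EuclideanSpace ℝ (Fin m)) (EuclideanSpace ℝ (Fin n)))‖ :=
    (continuous_exp.comp hVc.neg).mul (hDc.clm_comp continuous_const).norm
  obtain ⟨C, hC⟩ := ((isCompact_closedBall x₀ 1).prod hFb.isCompact_closure).exists_bound_of_continuousOn hGc.continuousOn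
  haveI : IsFiniteMeasure (volume.restrict F) :=
    ⟨by rw [Measure.restrict_apply_univ]; exact hFb.measure_lt_top⟩
  -- Mathlib's dominated differentiation lemma for `F x y = e^{−V(x,y)}`, `F' x y = e^{−V(x,y)} • −(DV(x,y) ∘ inl)`, bound `≡ C`
  have hF_meas : ∀ᶠ x in 𝓝 x₀, AEStronglyMeasurable (fun y => exp (-V (x, y))) (volume.restrict F) :=
    Filter.Eventually.of_forall fun x =>
      ((continuous_exp.comp hVc.neg).comp (Continuous.prodMk_right x)).aestronglyMeasurable
  have hF'_meas : AEStronglyMeasurable (fun y => exp (-V (x₀, y)) •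
      -((fderiv ℝ V (x₀, y)).comp (ContinuousLinearMap.inl ℝ (EuclideanSpace ℝ (Fin m)) (EuclideanSpace ℝ (Fin n)))))
      (volume.restrict F) :=
    (((continuous_exp.comp hVc.neg).smul (hDc.clm_comp continuous_const).neg).comp
      (Continuous.prodMk_right x₀)).aestronglyMeasurable
  have h_bound : ∀ᵐ y ∂(volume.restrict F), ∀ x ∈ ball x₀ 1, ‖exp (-V (x, y)) •
      -((fderiv ℝ V (x, y)).comp (ContinuousLinearMap.inl ℝ (EuclideanSpace ℝ (Fin m)) (EuclideanSpace ℝ (Fin n))))‖ ≤ C := by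
    rw [ae_restrict_iff' hF]
    refine ae_of_all _ fun y hy x hx => ?_
    have h := hC (x, y) ⟨mem_closedBall.2 (mem_ball.1 hx).le, subset_closure hy⟩
    rw [Real.norm_of_nonneg (mul_nonneg (exp_pos _).le (norm_nonneg _))] at h
    rwa [norm_smul, norm_neg, Real.norm_of_nonneg (exp_pos _).le]
  have h_diff : ∀ᵐ y ∂(volume.restrict F), ∀ x ∈ ball x₀ 1, HasFDerivAt (fun x => exp (-V (x, y))) (exp (-V (x, y)) •
      -((fderiv ℝ V (x, y)).comp (ContinuousLinearMap.inl ℝ (EuclideanSpace ℝ (Fin m)) (EuclideanSpace ℝ (Fin n))))) x :=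
    ae_of_all _ fun y x _ => (hasFDerivAt_base_of_contDiff hV x y).neg.exp
  have key := hasFDerivAt_integral_of_dominated_of_fderiv_le (𝕜 := ℝ) (μ := volume.restrict F)
    (F := fun x y => exp (-V (x, y)))
    (F' := fun x y => exp (-V (x, y)) •
      -((fderiv ℝ V (x, y)).comp (ContinuousLinearMap.inl ℝ (EuclideanSpace ℝ (Fin m)) (EuclideanSpace ℝ (Fin n)))))
    (bound := fun _ => C) (ball_mem_nhds x₀ one_pos) hF_meas
    (integrableOn_fibreWindow_of_continuous (continuous_exp.comp hVc.neg) hFb x₀) hF'_meas h_bound (integrable_const C) h_diff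
  have e : (∫ y in F, exp (-V (x₀, y)) •
      -((fderiv ℝ V (x₀, y)).comp (ContinuousLinearMap.inl ℝ (EuclideanSpace ℝ (Fin m)) (EuclideanSpace ℝ (Fin n))))) =
      -∫ y in F, exp (-V (x₀, y)) •
        (fderiv ℝ V (x₀, y)).comp (ContinuousLinearMap.inl ℝ (EuclideanSpace ℝ (Fin m)) (EuclideanSpace ℝ (Fin n))) := by
    rw [← integral_neg]
    refine integral_congr_ae (ae_of_all _ fun y => ?_)
    simp only [smul_neg]
  rw [e] at key
  exact key

/-- **THE WINDOWED MARGINAL EXPONENT IS DIFFERENTIABLE, WITH ITS DERIVATIVE**: `V` jointly `C¹`, `F` measurable, bounded, of positive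
volume ⊢ `x ↦ −log ∫_F e^{−V(x,y)} dy` has Fréchet derivative `(∫_F e^{−V(x₀,·)})⁻¹ • ∫_F e^{−V(x₀,y)} • (DV(x₀,y) ∘ inl) dy` at `x₀`.
[folklore] -/
theorem hasFDerivAt_negLogFibreWindowIntegral {V : EuclideanSpace ℝ (Fin m) × EuclideanSpace ℝ (Fin n) → ℝ} (hV : ContDiff ℝ 1 V)
    {F : Set (EuclideanSpace ℝ (Fin n))} (hF : MeasurableSet F) (hFb : Bornology.IsBounded F) (hF0 : volume F ≠ 0)
    (x₀ : EuclideanSpace ℝ (Fin m)) :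
    HasFDerivAt (fun x => -log (∫ y in F, exp (-V (x, y))))
      ((∫ y in F, exp (-V (x₀, y)))⁻¹ • ∫ y in F, exp (-V (x₀, y)) •
        (fderiv ℝ V (x₀, y)).comp (ContinuousLinearMap.inl ℝ (EuclideanSpace ℝ (Fin m)) (EuclideanSpace ℝ (Fin n)))) x₀ := by
  have h := ((hasFDerivAt_fibreWindowIntegral hV hF hFb x₀).log
    (fibreWindowIntegral_pos hV.continuous hFb hF0 x₀).ne').fun_neg
  simpa only [smul_neg, neg_neg] using h

/-- **`x ↦ −log ∫_F e^{−V(x,y)} dy` IS DIFFERENTIABLE ON ALL OF `ℝᵐ`** (`V` jointly `C¹`; `F` measurable, bounded, `volume F ≠ 0`).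
[folklore] -/
theorem differentiable_negLogFibreWindowIntegral {V : EuclideanSpace ℝ (Fin m) × EuclideanSpace ℝ (Fin n) → ℝ}
    (hV : ContDiff ℝ 1 V) {F : Set (EuclideanSpace ℝ (Fin n))} (hF : MeasurableSet F) (hFb : Bornology.IsBounded F)
    (hF0 : volume F ≠ 0) : Differentiable ℝ fun x => -log (∫ y in F, exp (-V (x, y))) :=
  fun x₀ => (hasFDerivAt_negLogFibreWindowIntegral hV hF hFb hF0 x₀).differentiableAt

/-- **THE GRADIENT FORMULA ON THE WINDOW**: `⟪∇V⁺(x₀), v⟫ = (∫_F e^{−V(x₀,y)}·DV(x₀,y)[(v,0)] dy) ∕ ∫_F e^{−V(x₀,y)} dy` — the fibre-tilted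
mean of the base directional derivative. [folklore] -/
theorem inner_gradient_negLogFibreWindowIntegral {V : EuclideanSpace ℝ (Fin m) × EuclideanSpace ℝ (Fin n) → ℝ}
    (hV : ContDiff ℝ 1 V) {F : Set (EuclideanSpace ℝ (Fin n))} (hF : MeasurableSet F) (hFb : Bornology.IsBounded F)
    (hF0 : volume F ≠ 0) (x₀ v : EuclideanSpace ℝ (Fin m)) :
    ⟪gradient (fun x => -log (∫ y in F, exp (-V (x, y)))) x₀, v⟫ =
      (∫ y in F, exp (-V (x₀, y)) * fderiv ℝ V (x₀, y) (v, 0)) / ∫ y in F, exp (-V (x₀, y)) := by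
  have h := hasFDerivAt_negLogFibreWindowIntegral hV hF hFb hF0 x₀
  have hcont : Continuous fun p : EuclideanSpace ℝ (Fin m) × EuclideanSpace ℝ (Fin n) =>
      exp (-V p) • (fderiv ℝ V p).comp (ContinuousLinearMap.inl ℝ (EuclideanSpace ℝ (Fin m)) (EuclideanSpace ℝ (Fin n))) :=
    (continuous_exp.comp hV.continuous.neg).smul ((hV.continuous_fderiv one_ne_zero).clm_comp continuous_const)
  have hV'int : Integrable (fun y => exp (-V (x₀, y)) •
      (fderiv ℝ V (x₀, y)).comp (ContinuousLinearMap.inl ℝ (EuclideanSpace ℝ (Fin m)) (EuclideanSpace ℝ (Fin n))))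
      (volume.restrict F) :=
    integrableOn_fibreWindow_of_continuous
      (f := fun p : EuclideanSpace ℝ (Fin m) × EuclideanSpace ℝ (Fin n) =>
        exp (-V p) • (fderiv ℝ V p).comp (ContinuousLinearMap.inl ℝ (EuclideanSpace ℝ (Fin m)) (EuclideanSpace ℝ (Fin n))))
      hcont hFb x₀
  rw [h.hasGradientAt.gradient, toDual_symm_apply, smul_apply, ContinuousLinearMap.integral_apply hV'int, smul_eq_mul,
    div_eq_inv_mul]
  refine congrArg (fun t => (∫ y in F, exp (-V (x₀, y)))⁻¹ * t) (integral_congr_ae (ae_of_all _ fun y => ?_))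
  simp only [smul_apply, ContinuousLinearMap.comp_apply, ContinuousLinearMap.inl_apply, smul_eq_mul]

end Window

/-! ## §2 The junction with the marginal letter's fibre form for a product window `K = B ×ˢ F`, WITHIN the base window -/

section Junction

variable {m n : ℕ}

/-- For `x ∈ B` the fibre of the product window is the fibre window: `∫_{(B ×ˢ F)_x} g = ∫_F g`. [folklore] -/
theorem setIntegral_fibre_prod_eq {G : Type*} [NormedAddCommGroup G] [NormedSpace ℝ G]
    {B : Set (EuclideanSpace ℝ (Fin m))} {F : Set (EuclideanSpace ℝ (Fin n))} {x : EuclideanSpace ℝ (Fin m)} (hx : x ∈ B)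
    (g : EuclideanSpace ℝ (Fin n) → G) :
    ∫ y in Prod.mk x ⁻¹' (B ×ˢ F), g y = ∫ y in F, g y := by
  rw [mk_preimage_prod_right hx]

/-- **DIFFERENTIABILITY WITHIN `B` OF THE MARGINAL EXPONENT OF A PRODUCT WINDOW** — the hypothesis `hd` of
`…StrongConvexFirstOrderWithin.firstOrderOn_within_of_strongConvexOn` for the function of
`…LogConcaveMarginal.strongConvexOn_neg_log_fibreIntegral` at `K = B ×ˢ F`: `V` jointly `C¹`, `F` measurable bounded with `volume F ≠ 0`, `x ∈ B` ⊢
`DifferentiableWithinAt ℝ (x ↦ −log ∫_{(B ×ˢ F)_x} e^{−V(x,·)}) B x` (on `B` the function IS §2's). [folklore] -/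
theorem differentiableWithinAt_negLogMarginal_prod {V : EuclideanSpace ℝ (Fin m) × EuclideanSpace ℝ (Fin n) → ℝ}
    (hV : ContDiff ℝ 1 V) {B : Set (EuclideanSpace ℝ (Fin m))} {F : Set (EuclideanSpace ℝ (Fin n))} (hF : MeasurableSet F)
    (hFb : Bornology.IsBounded F) (hF0 : volume F ≠ 0) {x : EuclideanSpace ℝ (Fin m)} (hx : x ∈ B) :
    DifferentiableWithinAt ℝ (fun x' => -log (∫ y in Prod.mk x' ⁻¹' (B ×ˢ F), exp (-V (x', y)))) B x := by
  refine ((differentiable_negLogFibreWindowIntegral hV hF hFb hF0 x).differentiableWithinAt).congr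
    (fun x' hx' => ?_) ?_
  · show -log (∫ y in Prod.mk x' ⁻¹' (B ×ˢ F), exp (-V (x', y))) = -log (∫ y in F, exp (-V (x', y)))
    rw [setIntegral_fibre_prod_eq hx']
  · show -log (∫ y in Prod.mk x ⁻¹' (B ×ˢ F), exp (-V (x, y))) = -log (∫ y in F, exp (-V (x, y)))
    rw [setIntegral_fibre_prod_eq hx]

end Junction

/-! ## §3 Non-vacuity -/

section Toy

variable {n : ℕ}

/-- Non-vacuity toy: every hypothesis of `differentiable_negLogFibreWindowIntegral` is jointly inhabited — `V = 0` (jointly `C^1`),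
`F` the open unit ball of `ℝⁿ` (measurable, bounded, positive volume). -/
example : Differentiable ℝ fun x : EuclideanSpace ℝ (Fin n) =>
    -log (∫ y in ball (0 : EuclideanSpace ℝ (Fin n)) 1,
      exp (-(fun _ : EuclideanSpace ℝ (Fin n) × EuclideanSpace ℝ (Fin n) => (0 : ℝ)) (x, y))) :=
  differentiable_negLogFibreWindowIntegral contDiff_const measurableSet_ball isBounded_ball
    (measure_ball_pos volume (0 : EuclideanSpace ℝ (Fin n)) one_pos).ne'

end Toy

end Summit.QuantumFields.BalabanUV.T4Continuum.NE7b.FibreWindowSmooth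

end
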